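import Summits.QuantumAdvantage.QuantumAdvantage.Statement
import Summits.QuantumAdvantage.QuantumAdvantage.Theorems.PhiHidingThree
import Mathlib.NumberTheory.NumberField.Units.Regulator

set_option linter.dupNamespace false

/-!
# BC2 piece probes (EXEMPT-46 re-exam, crux PureCubicClassNumberHard) — MUST-FAIL checks

For each candidate piece `C` of a decomposition of `X = PureCubicClassNumberHard`:
`example : C → S` and `example : C → X` by `first | exact? | simpa [C] | (unfold C; simpa) | aesop`
(protocol BC2 (c)); a probe that SUCCEEDS marks the piece as ≡ S / ≥ X by a trivial seam.
SELF-CERTIFYING FORM (so that the file elaborates and can live in the Cruxes dir): the two probes that SUCCEED are written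
with the term `exact?` found; every probe that must FAIL is wrapped `fail_if_success ((first | exact? | simpa [C] | (unfold C;
simpa) | aesop); done); sorry` (`done` because `aesop` returns non-terminally with a warning instead of failing) — so the file elaborates (21 − 2 = 19 sorries, warnings only) IFF every expected failure really fails.
Raw run of the unwrapped probes: lean check 2026-08-17, rc 1, 19 "unsolved goals" errors, wall 100 s (census §E46.4).
Imports: the Statement + `Theorems/PhiHidingThree` (which brings the landed Honda transfer, the
BQP-collapse pipeline and Shor into scope — the honest setting for "no landed theorem of shape C → S").
Piece definitions are copied verbatim from `StrategistReExam.lean` (not importable before publication).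
-/

namespace Summit.QuantumAdvantage.QuantumAdvantage.Cruxes.PureCubicClassNumberHard.ReExamProbes

open Literature.Computability.Complexity Literature.Computability.Complexity.Classes
open Literature.Computability.Complexity.Brick
open Literature.Computability.Cryptography _root_.Computability
open Summit.QuantumAdvantage.QuantumAdvantage.Theses.LinnikCubicClassGroups
open Summit.QuantumAdvantage.QuantumAdvantage.Theorems

def HondaBitHardPM1 : Prop :=
  ¬ ∃ D : RandAlg (List Bool) Bool, D.IsPolyTime id encodeBool ∧
    ∀ p q : ℕ, p.Prime → q.Prime → p ≠ q → ((p * q) % 9 = 1 ∨ (p * q) % 9 = 8) →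
      (2 : ℝ) / 3 ≤ D.pr id (encodeNat (p * q))
        {b | b = decide (¬ ((p % 9 = 2 ∨ p % 9 = 5) ∧ (q % 9 = 2 ∨ q % 9 = 5)))}

def ResidualHard : Prop :=
  Literature.Computability.QuantumComplexity.FACT ∈ BPP → PureCubicClassNumberHard

def FactoringWorldHard : Prop :=
  Literature.Computability.QuantumComplexity.FACT ∉ BPP → PureCubicClassNumberHard

def CollapseResidual : Prop :=
  BQP ⊆ BPP → PureCubicClassNumberHard

def SummitWorldHard : Prop :=
  _root_.QuantumAdvantage → PureCubicClassNumberHard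

def ThreeDivisibilityBitHard : Prop :=
  ¬ ∃ D : RandAlg (List Bool) Bool, D.IsPolyTime id encodeBool ∧
    ∀ (x : List Bool) (K : Type) [Field K] [NumberField K], Module.finrank ℚ K = 3 →
      (∀ r : ℕ, r ^ 3 ≠ decodeNat x) → (∃ α : K, α ^ 3 = (decodeNat x : K)) →
        (2 : ℝ) / 3 ≤ D.pr id x {b | b = decide (3 ∣ NumberField.classNumber K)}

def RSASplitHard : Prop :=
  ¬ ∃ A : RandAlg (List Bool) (List Bool), A.IsPolyTime id id ∧
    ∀ p q : ℕ, p.Prime → q.Prime → p ≠ q → Odd (p * q) →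
      (2 : ℝ) / 3 ≤ A.pr id (encodeNat (p * q)) {y | decodeNat y = p ∨ decodeNat y = q}

def CoarseRegulatorHard : Prop :=
  ¬ ∃ A : RandAlg (List Bool) (List Bool), A.IsPolyTime id id ∧
    ∀ (x : List Bool) (K : Type) [Field K] [NumberField K], Module.finrank ℚ K = 3 →
      (∀ r : ℕ, r ^ 3 ≠ decodeNat x) → (∃ α : K, α ^ 3 = (decodeNat x : K)) →
        (2 : ℝ) / 3 ≤ A.pr id x {y | NumberField.Units.regulator K / 2 ≤ (decodeNat y : ℝ) ∧
          (decodeNat y : ℝ) ≤ 2 * NumberField.Units.regulator K}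

/-! ### P0: the crux itself against the summit (bc2_audit: mechanical probe) -/
set_option maxHeartbeats 400000 in
example : PureCubicClassNumberHard → _root_.QuantumAdvantage := by
  -- probe must FAIL: the file elaborates only if the cheap tactics do not close the goal
  fail_if_success ((first | exact? | simpa [PureCubicClassNumberHard] | (unfold PureCubicClassNumberHard; simpa) | aesop); done)
  sorry
set_option maxHeartbeats 400000 in
example : _root_.QuantumAdvantage → PureCubicClassNumberHard := by
  -- probe must FAIL: the file elaborates only if the cheap tactics do not close the goal
  fail_if_success ((first | exact? | simpa [PureCubicClassNumberHard] | (unfold PureCubicClassNumberHard; simpa) | aesop); done)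
  sorry

/-! ### P1: PhiHidingThree (line Sketch's leaf) -/
set_option maxHeartbeats 400000 in
example : PhiHidingThree → _root_.QuantumAdvantage := by
  -- probe SUCCEEDS: `exact?` returns the landed bypass (the (c) violation of line Sketch)
  exact fun a => quantumAdvantage_of_phiHidingThree a
set_option maxHeartbeats 400000 in
example : PhiHidingThree → PureCubicClassNumberHard := by
  -- probe SUCCEEDS: `exact?` returns the landed assembly direction (leaf → X)
  exact fun a => pureCubicClassNumberHard_of_phiHidingThree a

/-! ### P2: HondaBitHardPM1 (the Honda reduction's interface) -/
set_option maxHeartbeats 400000 in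
example : HondaBitHardPM1 → _root_.QuantumAdvantage := by
  -- probe must FAIL: the file elaborates only if the cheap tactics do not close the goal
  fail_if_success ((first | exact? | simpa [HondaBitHardPM1] | (unfold HondaBitHardPM1; simpa) | aesop); done)
  sorry
set_option maxHeartbeats 400000 in
example : HondaBitHardPM1 → PureCubicClassNumberHard := by
  -- probe must FAIL: the file elaborates only if the cheap tactics do not close the goal
  fail_if_success ((first | exact? | simpa [HondaBitHardPM1] | (unfold HondaBitHardPM1; simpa) | aesop); done)
  sorry

/-! ### P3: ResidualHard -/
set_option maxHeartbeats 400000 in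
example : ResidualHard → _root_.QuantumAdvantage := by
  -- probe must FAIL: the file elaborates only if the cheap tactics do not close the goal
  fail_if_success ((first | exact? | simpa [ResidualHard] | (unfold ResidualHard; simpa) | aesop); done)
  sorry
set_option maxHeartbeats 400000 in
example : ResidualHard → PureCubicClassNumberHard := by
  -- probe must FAIL: the file elaborates only if the cheap tactics do not close the goal
  fail_if_success ((first | exact? | simpa [ResidualHard] | (unfold ResidualHard; simpa) | aesop); done)
  sorry

/-! ### P4: FactoringWorldHard -/
set_option maxHeartbeats 400000 in
example : FactoringWorldHard → _root_.QuantumAdvantage := by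
  -- probe must FAIL: the file elaborates only if the cheap tactics do not close the goal
  fail_if_success ((first | exact? | simpa [FactoringWorldHard] | (unfold FactoringWorldHard; simpa) | aesop); done)
  sorry
set_option maxHeartbeats 400000 in
example : FactoringWorldHard → PureCubicClassNumberHard := by
  -- probe must FAIL: the file elaborates only if the cheap tactics do not close the goal
  fail_if_success ((first | exact? | simpa [FactoringWorldHard] | (unfold FactoringWorldHard; simpa) | aesop); done)
  sorry

/-! ### P5: CollapseResidual -/
set_option maxHeartbeats 400000 in
example : CollapseResidual → _root_.QuantumAdvantage := by
  -- probe must FAIL: the file elaborates only if the cheap tactics do not close the goal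
  fail_if_success ((first | exact? | simpa [CollapseResidual] | (unfold CollapseResidual; simpa) | aesop); done)
  sorry
set_option maxHeartbeats 400000 in
example : CollapseResidual → PureCubicClassNumberHard := by
  -- probe must FAIL: the file elaborates only if the cheap tactics do not close the goal
  fail_if_success ((first | exact? | simpa [CollapseResidual] | (unfold CollapseResidual; simpa) | aesop); done)
  sorry
set_option maxHeartbeats 400000 in
example : _root_.QuantumAdvantage → CollapseResidual := by
  -- probe must FAIL: the file elaborates only if the cheap tactics do not close the goal
  fail_if_success ((first | exact? | simpa [CollapseResidual] | (unfold CollapseResidual; simpa) | aesop); done)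
  sorry

/-! ### P6: SummitWorldHard -/
set_option maxHeartbeats 400000 in
example : SummitWorldHard → _root_.QuantumAdvantage := by
  -- probe must FAIL: the file elaborates only if the cheap tactics do not close the goal
  fail_if_success ((first | exact? | simpa [SummitWorldHard] | (unfold SummitWorldHard; simpa) | aesop); done)
  sorry
set_option maxHeartbeats 400000 in
example : SummitWorldHard → PureCubicClassNumberHard := by
  -- probe must FAIL: the file elaborates only if the cheap tactics do not close the goal
  fail_if_success ((first | exact? | simpa [SummitWorldHard] | (unfold SummitWorldHard; simpa) | aesop); done)
  sorry

/-! ### P7: ThreeDivisibilityBitHard -/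
set_option maxHeartbeats 400000 in
example : ThreeDivisibilityBitHard → _root_.QuantumAdvantage := by
  -- probe must FAIL: the file elaborates only if the cheap tactics do not close the goal
  fail_if_success ((first | exact? | simpa [ThreeDivisibilityBitHard] | (unfold ThreeDivisibilityBitHard; simpa) | aesop); done)
  sorry
set_option maxHeartbeats 400000 in
example : ThreeDivisibilityBitHard → PureCubicClassNumberHard := by
  -- probe must FAIL: the file elaborates only if the cheap tactics do not close the goal
  fail_if_success ((first | exact? | simpa [ThreeDivisibilityBitHard] | (unfold ThreeDivisibilityBitHard; simpa) | aesop); done)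
  sorry

/-! ### P8: RSASplitHard -/
set_option maxHeartbeats 400000 in
example : RSASplitHard → _root_.QuantumAdvantage := by
  -- probe must FAIL: the file elaborates only if the cheap tactics do not close the goal
  fail_if_success ((first | exact? | simpa [RSASplitHard] | (unfold RSASplitHard; simpa) | aesop); done)
  sorry
set_option maxHeartbeats 400000 in
example : RSASplitHard → PureCubicClassNumberHard := by
  -- probe must FAIL: the file elaborates only if the cheap tactics do not close the goal
  fail_if_success ((first | exact? | simpa [RSASplitHard] | (unfold RSASplitHard; simpa) | aesop); done)
  sorry

/-! ### P9: CoarseRegulatorHard -/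
set_option maxHeartbeats 400000 in
example : CoarseRegulatorHard → _root_.QuantumAdvantage := by
  -- probe must FAIL: the file elaborates only if the cheap tactics do not close the goal
  fail_if_success ((first | exact? | simpa [CoarseRegulatorHard] | (unfold CoarseRegulatorHard; simpa) | aesop); done)
  sorry
set_option maxHeartbeats 400000 in
example : CoarseRegulatorHard → PureCubicClassNumberHard := by
  -- probe must FAIL: the file elaborates only if the cheap tactics do not close the goal
  fail_if_success ((first | exact? | simpa [CoarseRegulatorHard] | (unfold CoarseRegulatorHard; simpa) | aesop); done)
  sorry

end Summit.QuantumAdvantage.QuantumAdvantage.Cruxes.PureCubicClassNumberHard.ReExamProbes
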